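import Literature.Analysis.FluidPDE.ForwardDSSLimitDatumProofs
import Literature.Analysis.FluidPDE.SelfSimilarLiouvilleProofs
import Literature.Analysis.FluidPDE.ForwardDSSMollifiedScheme
import Literature.Analysis.FluidPDE.NSCylinderVelocityCompactness
import Literature.Analysis.FluidPDE.WeakGradientWeakLimitL2
import Literature.Analysis.FluidPDE.SuitableWeakStability
import Literature.Analysis.FluidPDE.ParabolicInterpolationTenThirds
import Literature.Analysis.FunctionSpaces.WeakCompactnessLpFinite
import Literature.Analysis.FunctionSpaces.LpInterpolationConvergence
import HarnessLib

/-!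
# Forward DSS solutions: proof of the interior compactness fact
`bradshawTsai2019_cylinderCompactness`, and Theorem 1.2 of Bradshaw–Tsai 2019 from Prop. 3.1 alone

Analysis/FluidPDE proofs file (no new definitions) **discharging the named fact**
`Literature.Analysis.FluidPDE.bradshawTsai2019_cylinderCompactness` (`ForwardDSSCylinderLimitParts.lean`):
the compactness and stability of suitable weak solutions on the unit cylinder `W = (0,T) × B₁`,
the first of the two DSS-free parts of the limit step of Bradshaw–Tsai, *Discretely self-similar
solutions to the Navier–Stokes equations with data in `L²_loc` satisfying the local energy
inequality*, Analysis & PDE 12 (2019) = arXiv:1801.08060, §4.3 (p. 12): "`vₖ` are uniformly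
bounded in `L^∞(0,T;L²(B₁)) ∩ L²(0,T;H¹(B₁))`, hence also in `L^{10/3}` … As usual (cf. [BT1,
KiSe, LR2]), there exists a distribution `v` and a subsequence … so that `vₖ` converges to `v` in
the weak star topology on `L^∞(0,T;L²(B₁))`, in the weak topology on `L²(0,T;H¹(B₁))`, and in
`L²(0,T;L²(B₁))` … `πₖ` … converges weakly to … `π ∈ L^{3/2}` … The local energy inequality for
`v` plainly follows" (the classical compactness of suitable weak solutions: Lin 1998, Thm. 2.2).

## The proof (`bradshawTsai2019_cylinderCompactness_holds`)

All the analysis is in accepted files; this file is the extraction bookkeeping.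

1. *Velocities* (`NSCylinder.exists_subseq_strong_limit_velocity_ball`, Aubin–Lions on the
   cylinder from the equicontinuity of the pairings, Ehrling and Rellich): a subsequence `σ₁` and
   a jointly measurable `u` with `esssup_t ∫_{B₁}|u(t)|² ≤ C` and `v_{σ₁ j} → u` in `L²(W)`.
2. *`L³`* (`exists_setLIntegral_rpow_ten_thirds_le`: `∫∫_W |vₖ|^{10/3} ≤ M(C, T)` uniformly;
   `FunctionSpaces.tendsto_eLpNorm_three_of_sq_of_tenThirds`): `v_{σ₁ j} → u` in `L³(W)`,
   `u, vₖ ∈ L³(W)`.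
3. *Pressures* (`FunctionSpaces.exists_subseq_tendsto_integral_mul_of_lintegral_rpow_le`,
   Dunford–Pettis): a further subsequence `σ₂` and `p ∈ L^{3/2}(W)` with
   `π_{σ₁σ₂ j} ⇀ p` weakly in `L^{3/2}(W)` and `∫∫_W |p|^{3/2} ≤ C`.
4. *Gradients* (`exists_hasWeakSpatialGradientOn_of_weakGradient_approx_L2`, weak compactness in
   `L²(W; E^d)`): a further subsequence `κ` and a weak spatial gradient `G` of `u` on `W` with
   `∫∫_W |G|² ≤ C` and `∇v_{σ j} a ⇀ G a` weakly in `L²(W)` for every direction `a`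
   (`σ = σ₁ ∘ σ₂ ∘ κ`).
5. *Stability* (`isSuitableWeakSolutionOn_of_tendsto`): `(u, p)` is a suitable weak solution on
   `W` — the equations pass to the limit, the right-hand side of the local energy inequality
   converges and its left-hand side is lower semicontinuous.

## Consequences

* `bradshawTsai2019_cylinderLimit_holds`, `bradshawTsai2019_limit_4_3_holds`,
  `bradshawTsai2019_limit_4_3_local_holds`: **the limit step of §4.3 is fully proved** (with the
  accepted `bradshawTsai2019_limitDatum_holds` and the DSS bookkeeping of
  `ForwardDSSCylinderLimitProofs` / `ForwardDSSLimitOriginal`).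
* `bradshawTsai2019_dss_existence_of_prop_3_1`, `…_of_prop_3_1_dss`, `…_of_prop_3_1_scheme`,
  `…_of_mollifiedScheme_apriori`: **Theorem 1.2** (`bradshawTsai2019_dss_existence`, and the
  historical `chae_wolf_dss_existence`) **now rests on Proposition 3.1 alone** — in the finest
  accepted splitting, on `{bradshawTsai2019_mollifiedScheme, bradshawTsai2019_apriori_3_12}`
  (the [BT1] construction with its mollified approximants, and the a priori estimate (3.12)).

## References

* Z. Bradshaw, T.-P. Tsai, Analysis & PDE 12 (2019) 1943–1962 = arXiv:1801.08060, §4.3 (proof of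
  Thm 1.2, p. 12) [BradshawTsai2019].
* F. Lin, *A new proof of the Caffarelli–Kohn–Nirenberg theorem*, CPAM 51 (1998), Thm. 2.2 [Lin1998].
* L. Caffarelli, R. Kohn, L. Nirenberg, CPAM 35 (1982), §2 [CaffarelliKohnNirenberg1982].
* P. G. Lemarié-Rieusset, *The Navier–Stokes problem in the 21st century* (2016), Thm. 12.1–12.2,
  Thm. 14.1 [Lemarierieusset2016].
-/

noncomputable section

open MeasureTheory TopologicalSpace Set Function Filter Metric
open scoped NNReal ENNReal Topology InnerProductSpace RealInnerProductSpace

namespace Literature.Analysis.FluidPDE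

/-! ## The discharge -/

set_option maxHeartbeats 800000 in
/-- **Compactness and stability of suitable weak solutions on the unit cylinder**
(Bradshaw–Tsai 2019, §4.3, arXiv p. 12, "As usual (cf. [BT1, KiSe, LR2]), there exists a
distribution `v` and a subsequence …"; Lin 1998, Thm. 2.2): **proof of the named fact
`bradshawTsai2019_cylinderCompactness`.** See the module docstring for the five steps (strong
`L²` compactness of the velocities, the `L^{10/3}` bound and `L³` convergence, weak `L^{3/2}`
compactness of the pressures, weak `L²` compactness of the gradients, stability of suitability).
[cite: BradshawTsai2019, §4.3 (proof of Thm 1.2, arXiv p. 12)] -/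
theorem bradshawTsai2019_cylinderCompactness_holds : bradshawTsai2019_cylinderCompactness := by
  intro v π T C hsuit hT hE hG hP
  -- ## notation and finiteness
  set S : Set (ℝ × (EuclideanSpace ℝ (Fin 3))) := Ioo 0 T ×ˢ ball (0 : (EuclideanSpace ℝ (Fin 3))) 1 with hS
  have hWS : ((timeCylinder unitBall 0 T : Opens (ℝ × (EuclideanSpace ℝ (Fin 3)))) : Set (ℝ × (EuclideanSpace ℝ (Fin 3)))) = S := rfl
  have hSfin : volume S ≠ ∞ := by
    rw [hS, Measure.volume_eq_prod, Measure.prod_prod]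
    exact ENNReal.mul_ne_top measure_Ioo_lt_top.ne measure_ball_lt_top.ne
  haveI hfinS : IsFiniteMeasure (volume.restrict S) :=
    ⟨by rw [Measure.restrict_apply_univ]; exact hSfin.lt_top⟩
  have hCtop : ((C : ℝ≥0) : ℝ≥0∞) ≠ ⊤ := ENNReal.coe_ne_top
  have hvm : ∀ k, AEStronglyMeasurable (uncurry (v k)) (volume.restrict S) := fun k =>
    (hsuit k).distributional.1.aestronglyMeasurable
  have hπm : ∀ k, AEStronglyMeasurable (uncurry (π k)) (volume.restrict S) := fun k =>
    (hsuit k).distributional.2.2.1.aestronglyMeasurable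
  choose Gv hGw hGb using hG
  -- ## Step 1: strong `L²` compactness of the velocities
  obtain ⟨σ₁, u, hσ₁, hum, huE, hus, -⟩ :=
    NSCylinder.exists_subseq_strong_limit_velocity_ball (0 : (EuclideanSpace ℝ (Fin 3))) 1 (a := 0) (b := T)
      (v := v) (π := π) hCtop hCtop hCtop (fun k => (hsuit k).distributional) hE
      (fun k => ⟨Gv k, hGw k, hGb k⟩) hP
  -- ## Step 2: the uniform `L^{10/3}` bound, `L³` convergence and the `L³` classes
  obtain ⟨C₀, hC₀⟩ := exists_setLIntegral_rpow_ten_thirds_le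
  set M : ℝ≥0∞ := C₀ * (C : ℝ≥0∞) ^ (2 / 3 : ℝ) * (ENNReal.ofReal (T - 0) * C + C) with hM
  have hMtop : M ≠ ∞ := by
    refine ENNReal.mul_ne_top (ENNReal.mul_ne_top ENNReal.coe_ne_top
      (ENNReal.rpow_ne_top_of_nonneg (by norm_num) hCtop)) ?_
    exact ENNReal.add_ne_top.2 ⟨ENNReal.mul_ne_top ENNReal.ofReal_ne_top hCtop, hCtop⟩
  have h103 : ∀ k, ∫⁻ z in S, ‖v k z.1 z.2‖ₑ ^ (10 / 3 : ℝ) ≤ M := fun k => by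
    refine (hC₀ 0 T (v k) (Gv k) C (hGw k) hCtop (hE k)).trans ?_
    rw [hM]
    gcongr
    exact hGb k
  have hL3 : Tendsto (fun j => eLpNorm (uncurry (v (σ₁ j)) - uncurry u) 3 (volume.restrict S))
      atTop (𝓝 0) :=
    FunctionSpaces.tendsto_eLpNorm_three_of_sq_of_tenThirds (f := fun j => uncurry (v (σ₁ j)))
      (g := uncurry u) (fun j => hvm (σ₁ j)) hum hus hMtop (fun j => h103 (σ₁ j))
  have hu3 : MemLp (uncurry u) 3 (volume.restrict S) :=
    FunctionSpaces.memLp_three_limit_of_sq_of_tenThirds (f := fun j => uncurry (v (σ₁ j)))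
      (g := uncurry u) (fun j => hvm (σ₁ j)) hum hus hMtop (fun j => h103 (σ₁ j))
  have hv3 : ∀ k, MemLp (uncurry (v k)) 3 (volume.restrict S) := fun k =>
    FunctionSpaces.memLp_three_of_lintegral_tenThirds_le (hvm k) hMtop (h103 k)
  have hu1 : LocallyIntegrableOn (uncurry u)
      ((timeCylinder unitBall 0 T : Opens (ℝ × (EuclideanSpace ℝ (Fin 3)))) : Set (ℝ × (EuclideanSpace ℝ (Fin 3)))) volume := by
    rw [hWS]
    have hi : IntegrableOn (uncurry u) S volume := hu3.integrable (by norm_num)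
    exact hi.locallyIntegrableOn
  -- ## Step 3: weak `L^{3/2}` compactness of the pressures along `σ₁`
  have hpq : (3 / 2 : ℝ).HolderConjugate 3 :=
    Real.holderConjugate_iff.2 ⟨by norm_num, by norm_num⟩
  obtain ⟨σ₂, hσ₂, g, hgmem, hgb, hgw⟩ :=
    FunctionSpaces.exists_subseq_tendsto_integral_mul_of_lintegral_rpow_le
      (μ := volume.restrict S) hpq (f := fun j => uncurry (π (σ₁ j))) (fun j => hπm (σ₁ j))
      hCtop (fun j => hP (σ₁ j))
  -- the limit pressure as a curried field
  set p : ℝ → (EuclideanSpace ℝ (Fin 3)) → ℝ := fun t x => g (t, x) with hp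
  have hpg : uncurry p = g := by funext z; rfl
  have hpm : AEStronglyMeasurable (uncurry p) (volume.restrict S) := by rw [hpg]; exact hgmem.1
  have hpb : ∫⁻ z in S, ‖p z.1 z.2‖ₑ ^ (3 / 2 : ℝ) ≤ C :=
    hgb.trans (liminf_le_of_frequently_le' (Frequently.of_forall fun n => hP (σ₁ (σ₂ n))))
  have e3 : ENNReal.ofReal 3 = 3 := ENNReal.ofReal_ofNat 3
  have hπw : ∀ g' : ℝ × (EuclideanSpace ℝ (Fin 3)) → ℝ, MemLp g' 3 (volume.restrict S) →
      Tendsto (fun n => ∫ z in S, π (σ₁ (σ₂ n)) z.1 z.2 * g' z) atTop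
        (𝓝 (∫ z in S, p z.1 z.2 * g' z)) := by
    intro g' hg'
    have h := hgw g' (by rwa [e3])
    exact h
  -- ## Step 4: weak `L²` compactness of the gradients along `σ₁ ∘ σ₂`
  have h2S : Tendsto (fun j => eLpNorm (uncurry (v (σ₁ j)) - uncurry u) 2 (volume.restrict S))
      atTop (𝓝 0) :=
    FunctionSpaces.tendsto_eLpNorm_two_of_tendsto_lintegral_sq (f := fun j => uncurry (v (σ₁ j)))
      (g := uncurry u) hus
  have hconv1 : ∀ K ⊆ ((timeCylinder unitBall 0 T : Opens (ℝ × (EuclideanSpace ℝ (Fin 3)))) : Set (ℝ × (EuclideanSpace ℝ (Fin 3)))),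
      IsCompact K →
      Tendsto (fun n => eLpNorm (fun z => uncurry (v (σ₁ (σ₂ n))) z - uncurry u z) 1
        (volume.restrict K)) atTop (𝓝 0) := by
    intro K hKS hKc
    rw [hWS] at hKS
    have hKfin : volume K ≠ ∞ := hKc.measure_lt_top.ne
    have hbound : ∀ n, eLpNorm (fun z => uncurry (v (σ₁ (σ₂ n))) z - uncurry u z) 1
        (volume.restrict K) ≤
        volume K ^ (1 / 2 : ℝ) * eLpNorm (uncurry (v (σ₁ (σ₂ n))) - uncurry u) 2
          (volume.restrict S) := by
      intro n
      have hm : AEStronglyMeasurable (uncurry (v (σ₁ (σ₂ n))) - uncurry u)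
          (volume.restrict K) :=
        ((hvm _).sub hum).mono_measure (Measure.restrict_mono hKS le_rfl)
      calc eLpNorm (fun z => uncurry (v (σ₁ (σ₂ n))) z - uncurry u z) 1 (volume.restrict K)
          = ∫⁻ z in K, ‖(uncurry (v (σ₁ (σ₂ n))) - uncurry u) z‖ₑ := by
            rw [eLpNorm_one_eq_lintegral_enorm]; rfl
        _ ≤ (volume.restrict K) univ ^ (1 / 2 : ℝ) *
              eLpNorm (uncurry (v (σ₁ (σ₂ n))) - uncurry u) 2 (volume.restrict K) :=
            lintegral_enorm_le_measure_univ_mul_eLpNorm_two hm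
        _ ≤ volume K ^ (1 / 2 : ℝ) *
              eLpNorm (uncurry (v (σ₁ (σ₂ n))) - uncurry u) 2 (volume.restrict S) := by
            rw [Measure.restrict_apply_univ]
            gcongr
    have hlim : Tendsto (fun n => volume K ^ (1 / 2 : ℝ) *
        eLpNorm (uncurry (v (σ₁ (σ₂ n))) - uncurry u) 2 (volume.restrict S)) atTop (𝓝 0) := by
      have h := ENNReal.Tendsto.const_mul (h2S.comp hσ₂.tendsto_atTop)
        (a := volume K ^ (1 / 2 : ℝ)) (Or.inr (ENNReal.rpow_ne_top_of_nonneg (by norm_num) hKfin))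
      rwa [mul_zero] at h
    exact tendsto_of_tendsto_of_tendsto_of_le_of_le tendsto_const_nhds hlim (fun _ => zero_le)
      hbound
  obtain ⟨Gu, κ, hκ, hGuW, -, hGub, hGweak, -, -⟩ :=
    exists_hasWeakSpatialGradientOn_of_weakGradient_approx_L2 (Ω := timeCylinder unitBall 0 T)
      (u := u) hu1 (V := fun n => v (σ₁ (σ₂ n))) (Gn := fun n => Gv (σ₁ (σ₂ n)))
      (fun n => hGw _) hconv1 hCtop (fun n => hGb _)
  -- ## Step 5: the final subsequence and the stability of suitability
  have hστ : StrictMono fun n => σ₁ (σ₂ (κ n)) := hσ₁.comp (hσ₂.comp hκ)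
  have husσ : Tendsto (fun n => ∫⁻ z in S, ‖v (σ₁ (σ₂ (κ n))) z.1 z.2 - u z.1 z.2‖ₑ ^ 2) atTop
      (𝓝 0) :=
    hus.comp ((hσ₂.comp hκ).tendsto_atTop)
  have hL3σ : Tendsto (fun n => eLpNorm (uncurry (v (σ₁ (σ₂ (κ n)))) - uncurry u) 3
      (volume.restrict S)) atTop (𝓝 0) :=
    hL3.comp ((hσ₂.comp hκ).tendsto_atTop)
  have hπwσ : ∀ g' : ℝ × (EuclideanSpace ℝ (Fin 3)) → ℝ, MemLp g' 3 (volume.restrict S) →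
      Tendsto (fun n => ∫ z in S, π (σ₁ (σ₂ (κ n))) z.1 z.2 * g' z) atTop
        (𝓝 (∫ z in S, p z.1 z.2 * g' z)) := fun g' hg' =>
    (hπw g' hg').comp hκ.tendsto_atTop
  -- the energy class of the limit in the indicator form
  have huEK : ∀ K ⊆ ((timeCylinder unitBall 0 T : Opens (ℝ × (EuclideanSpace ℝ (Fin 3)))) : Set (ℝ × (EuclideanSpace ℝ (Fin 3)))),
      IsCompact K → ∃ C' : ℝ≥0, ∀ᵐ t : ℝ,
        ∫⁻ x, K.indicator (fun z : ℝ × (EuclideanSpace ℝ (Fin 3)) => ‖u z.1 z.2‖ₑ ^ 2) (t, x) ≤ C' := by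
    intro K hKS _hKc
    rw [hWS] at hKS
    refine ⟨C, ?_⟩
    have h1 : ∀ᵐ t : ℝ, t ∈ Ioo 0 T → ∫⁻ x in ball (0 : (EuclideanSpace ℝ (Fin 3))) 1, ‖u t x‖ₑ ^ 2 ≤ C :=
      (ae_restrict_iff' measurableSet_Ioo).1 huE
    filter_upwards [h1] with t ht
    by_cases htI : t ∈ Ioo 0 T
    · calc ∫⁻ x, K.indicator (fun z : ℝ × (EuclideanSpace ℝ (Fin 3)) => ‖u z.1 z.2‖ₑ ^ 2) (t, x)
          ≤ ∫⁻ x, (ball (0 : (EuclideanSpace ℝ (Fin 3))) 1).indicator (fun x => ‖u t x‖ₑ ^ 2) x := by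
            refine lintegral_mono fun x => ?_
            by_cases hx : (t, x) ∈ K
            · have hxB : x ∈ ball (0 : (EuclideanSpace ℝ (Fin 3))) 1 := (hKS hx).2
              rw [indicator_of_mem hx, indicator_of_mem hxB]
            · rw [indicator_of_notMem hx]
              exact zero_le
        _ = ∫⁻ x in ball (0 : (EuclideanSpace ℝ (Fin 3))) 1, ‖u t x‖ₑ ^ 2 := lintegral_indicator measurableSet_ball _
        _ ≤ C := ht htI
    · have h0 : ∀ x, K.indicator (fun z : ℝ × (EuclideanSpace ℝ (Fin 3)) => ‖u z.1 z.2‖ₑ ^ 2) (t, x) = 0 := fun x =>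
        indicator_of_notMem (fun hx => htI (hKS hx).1) _
      simp only [h0, lintegral_const, zero_mul]
      exact zero_le
  have hsuitu : IsSuitableWeakSolutionOn (timeCylinder unitBall 0 T) 1 0 u p :=
    isSuitableWeakSolutionOn_of_tendsto (Q := timeCylinder unitBall 0 T) hSfin zero_le_one
      (v := fun n => v (σ₁ (σ₂ (κ n)))) (π := fun n => π (σ₁ (σ₂ (κ n))))
      (G := fun n => Gv (σ₁ (σ₂ (κ n)))) (u := u) (p := p) (Gu := Gu) (Cp := C) hCtop
      (fun n => hsuit _) (fun n => hGw _) (fun n => hv3 _) (fun n => hP _) hu3 hpm hpb hGuW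
      (hGub.trans_lt ENNReal.coe_lt_top) huEK hL3σ hπwσ hGweak
  exact ⟨fun n => σ₁ (σ₂ (κ n)), u, p, hστ, hsuitu, huE, ⟨Gu, hGuW, hGub⟩, hpb, husσ, hπwσ⟩

/-! ## Consequences: the limit step of §4.3, and Theorem 1.2 from Prop. 3.1 alone -/

/-- **The compactness fact on the unit cylinder** `bradshawTsai2019_cylinderLimit` (the DSS-free
analytic core of the limit step of Bradshaw–Tsai 2019, §4.3) **holds**: interior compactness
(`bradshawTsai2019_cylinderCompactness_holds`) and the continuity of the limit at `t = 0`
(`bradshawTsai2019_limitDatum_holds`). [cite: BradshawTsai2019, §4.3 (proof of Thm 1.2)] -/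
theorem bradshawTsai2019_cylinderLimit_holds : bradshawTsai2019_cylinderLimit :=
  bradshawTsai2019_cylinderLimit_of_compactness bradshawTsai2019_cylinderCompactness_holds

/-- **The limit step of Bradshaw–Tsai 2019, §4.3 (with the extension of §4.2), as vendored in
`ForwardDSSExistence.lean`, holds.** [cite: BradshawTsai2019, §4.3 with §4.2 (proof of Thm 1.2)] -/
theorem bradshawTsai2019_limit_4_3_holds : bradshawTsai2019_limit_4_3 :=
  bradshawTsai2019_limit_4_3_of_compactness bradshawTsai2019_cylinderCompactness_holds

/-- **The local form of the limit step (`ForwardDSSExistenceLocal.lean`) holds.** [cite: BradshawTsai2019, §4.3 (proof of Thm 1.2)] -/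
theorem bradshawTsai2019_limit_4_3_local_holds : bradshawTsai2019_limit_4_3_local :=
  bradshawTsai2019_limit_4_3_local_of_cylinderLimit bradshawTsai2019_cylinderLimit_holds

/-- **Theorem 1.2 of Bradshaw–Tsai 2019 from Proposition 3.1 (as printed) alone**: Lemma 4.1
(`bradshawTsai2019_lemma_4_1_holds`), the limit step (`bradshawTsai2019_limit_4_3_holds`) and the
assembly are proved in the tree. [cite: BradshawTsai2019, Thm 1.2 (proof, §4.3)] -/
theorem bradshawTsai2019_dss_existence_of_prop_3_1 (h31 : bradshawTsai2019_prop_3_1) :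
    bradshawTsai2019_dss_existence :=
  bradshawTsai2019_dss_existence_of_prop_3_1_compactness bradshawTsai2019_lemma_4_1_holds h31
    bradshawTsai2019_cylinderCompactness_holds

/-- **Theorem 1.2 from Prop. 3.1 with the DSS pressure clause** (`bradshawTsai2019_prop_3_1_dss`).
[cite: BradshawTsai2019, Thm 1.2 (proof, §4.3)] -/
theorem bradshawTsai2019_dss_existence_of_prop_3_1_dss (h31 : bradshawTsai2019_prop_3_1_dss) :
    bradshawTsai2019_dss_existence :=
  bradshawTsai2019_dss_existence_of_local_parts bradshawTsai2019_lemma_4_1_holds h31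
    bradshawTsai2019_limit_4_3_local_holds

/-- **Theorem 1.2 from the scheme form of Prop. 3.1** (`bradshawTsai2019_prop_3_1_scheme`, the
a priori estimate for the [BT1] scheme). [cite: BradshawTsai2019, Thm 1.2 (proof, §3–§4)] -/
theorem bradshawTsai2019_dss_existence_of_prop_3_1_scheme (h31 : bradshawTsai2019_prop_3_1_scheme) :
    bradshawTsai2019_dss_existence :=
  bradshawTsai2019_dss_existence_of_scheme_of_limit_4_3_local h31
    bradshawTsai2019_limit_4_3_local_holds

/-- **Theorem 1.2 from the two remaining named facts of the finest splitting of Prop. 3.1**: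
`bradshawTsai2019_mollifiedScheme` (the [BT1] construction with its mollified approximants) and
`bradshawTsai2019_apriori_3_12` (the a priori estimate (3.12)). This is the current trust base of
`bradshawTsai2019_dss_existence` in the tree. [cite: BradshawTsai2019, Thm 1.2 (proof, §3–§4)] -/
theorem bradshawTsai2019_dss_existence_of_mollifiedScheme_apriori
    (hA : bradshawTsai2019_mollifiedScheme) (hB : bradshawTsai2019_apriori_3_12) :
    bradshawTsai2019_dss_existence :=
  bradshawTsai2019_dss_existence_of_prop_3_1_scheme (bradshawTsai2019_prop_3_1_scheme_of_parts hA hB)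

/-- The historical `chae_wolf_dss_existence` from Prop. 3.1 alone. [cite: BradshawTsai2019, Thm 1.2] -/
theorem chae_wolf_dss_existence_of_prop_3_1 (h31 : bradshawTsai2019_prop_3_1) :
    chae_wolf_dss_existence :=
  chae_wolf_dss_existence_of_bradshawTsai2019 (bradshawTsai2019_dss_existence_of_prop_3_1 h31)

/-- The historical `chae_wolf_dss_existence` from the two remaining named facts. [cite: BradshawTsai2019, Thm 1.2] -/
theorem chae_wolf_dss_existence_of_mollifiedScheme_apriori
    (hA : bradshawTsai2019_mollifiedScheme) (hB : bradshawTsai2019_apriori_3_12) :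
    chae_wolf_dss_existence :=
  chae_wolf_dss_existence_of_bradshawTsai2019
    (bradshawTsai2019_dss_existence_of_mollifiedScheme_apriori hA hB)

/-- The rendered Chae–Wolf existence statement `chaeWolf2018_dss_existence` (Chae–Wolf 2018,
Thm 1.4; "a slight refinement of the main result of [Chae–Wolf]", Bradshaw–Tsai 2019, Comments on
Thm 1.2) from Prop. 3.1 alone. [cite: BradshawTsai2019, Comments on Thm 1.2] -/
theorem chaeWolf2018_dss_existence_of_prop_3_1 (h31 : bradshawTsai2019_prop_3_1) :
    chaeWolf2018_dss_existence :=
  chaeWolf2018_dss_existence_of_bradshawTsai2019 (bradshawTsai2019_dss_existence_of_prop_3_1 h31)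

/-- `chaeWolf2018_dss_existence` from the scheme form of Prop. 3.1. [cite: BradshawTsai2019, Comments on Thm 1.2] -/
theorem chaeWolf2018_dss_existence_of_prop_3_1_scheme (h31 : bradshawTsai2019_prop_3_1_scheme) :
    chaeWolf2018_dss_existence :=
  chaeWolf2018_dss_existence_of_bradshawTsai2019
    (bradshawTsai2019_dss_existence_of_prop_3_1_scheme h31)

/-- `chaeWolf2018_dss_existence` from the two remaining named facts
`bradshawTsai2019_mollifiedScheme` and `bradshawTsai2019_apriori_3_12`. [cite: BradshawTsai2019, Comments on Thm 1.2] -/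
theorem chaeWolf2018_dss_existence_of_mollifiedScheme_apriori
    (hA : bradshawTsai2019_mollifiedScheme) (hB : bradshawTsai2019_apriori_3_12) :
    chaeWolf2018_dss_existence :=
  chaeWolf2018_dss_existence_of_bradshawTsai2019
    (bradshawTsai2019_dss_existence_of_mollifiedScheme_apriori hA hB)

end Literature.Analysis.FluidPDE
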